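import Summits.CriticalPhenomena.PercolationContinuityZ3.Theorems.PercNearOneGluingAdditiveGluingSandwichCondAssocT
import Summits.CriticalPhenomena.PercolationContinuityZ3.Theorems.PercNearOneGluingAdditiveGluingKnThm2Good
import Summits.CriticalPhenomena.PercolationContinuityZ3.Theorems.PercNearOneGluingAdditiveGluingKnLemma2
import HarnessLib

/-!
# Kozma–Nitzan's Theorem 2 for a VIRTUAL observer (bystander form): three relays, good case,
# with dead-pocket families

Crux `PercNearOneGluing.AdditiveGluing` (stmt-CriticalPhenomena-4576), line
`subuniform-dead-pocket-maximum`, stub `stub_goodStep` — TTRL deep variant V1362 (GOOD for three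
relays `a₁, a₂, a₃` in KN's good case `m₃ ≤ m₁₂`, `a₃` worst, WITH the dead-pocket penalty of an
adversarial selection); lands with `--supports stmt-CriticalPhenomena-4576`.  No new definitions.

Notation (KN arXiv:2401.12397 §3.2): `N₁₂ = {a₁↮a₃} ∩ {a₂↮a₃}`, `N₁ = {a₁↮a₂} ∩ {a₁↮a₃}`,
`N₂ = {a₂↮a₁} ∩ {a₂↮a₃}`; `D_j = {C(o) ∈ 𝓡_j}` for two disjoint families `𝓡₁, 𝓡₂` of vertex sets
avoiding `a₁, a₂, a₃` (the dead pockets the selection sends to `a₁`, resp. `a₂`); the BYSTANDER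
(virtual-observer) events `O₁ = {a₁↔o} ∪ D₁`, `O₂ = {a₂↔o} ∪ D₂`, `O₁₂ = {a₁↔o} ∪ {a₂↔o} ∪ D₁ ∪ D₂`.

`bystanderThm2_core`: `0 ≤ I* + II* + III*`, where `I*, II*, III*` are KN's `I, II, III` (p. 8) with
`{o ↔ A₁₂}, {o ↔ a₁}, {o ↔ a₂}` replaced by `O₁₂, O₁, O₂`.  Proof = KN's proof of Theorem 2 (p. 9) in
which each of the six BHK applications and the three BHK applications inside Lemma 2 is replaced by
the corresponding SANDWICH inequality (`sandwich_setSource_pos/neg`, file `…SandwichCondAssocT`: the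
bystander event is a sandwich event of the observer's cluster for the relevant source set, the dead
pockets avoiding every relay); the real arithmetic is KN's verbatim (`knLemma2_arith`, `knThm2_arith`).
-/

namespace Summit.CriticalPhenomena.PercolationContinuityZ3.Theorems

open MeasureTheory Set Literature.Probability.LatticeModels Literature.Probability.Percolation

noncomputable section
open Classical

variable {n : ℕ}

/-- `{x ↔ x}` is everything. [folklore] -/
theorem v1362_openConn_self (x : Fin n) : (openConn x x : Set (BondConfig (Fin n))) = Set.univ :=
  Set.eq_univ_of_forall fun _ => SimpleGraph.Reachable.refl _

/-- `⋂_{s ∈ {a}} {s ↔ x} = {a ↔ x}`. [folklore] -/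
theorem v1362_biInter_single (a x : Fin n) :
    (⋂ s ∈ ({a} : Finset (Fin n)), (openConn s x : Set (BondConfig (Fin n)))) = openConn a x := by
  rw [Finset.set_biInter_singleton]

/-- `⋂_{s ∈ {a, c}} {s ↔ x} = {a ↔ x} ∩ {c ↔ x}`. [folklore] -/
theorem v1362_biInter_pair (a c x : Fin n) :
    (⋂ s ∈ ({a, c} : Finset (Fin n)), (openConn s x : Set (BondConfig (Fin n)))) =
      openConn a x ∩ openConn c x := by
  rw [Finset.set_biInter_insert, Finset.set_biInter_singleton]

/-- `⋂_{s ∈ {a, c}} {s ↔ c} = {a ↔ c}`. [folklore] -/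
theorem v1362_biInter_pair_self (a c : Fin n) :
    (⋂ s ∈ ({a, c} : Finset (Fin n)), (openConn s c : Set (BondConfig (Fin n)))) = openConn a c := by
  rw [v1362_biInter_pair, v1362_openConn_self, Set.inter_univ]

/-- **Bystander Kozma–Nitzan Theorem 2, core inequality `0 ≤ I* + II* + III*`.**  For relays
`a₁, a₂, a₃` (distinctness is not needed) with `a₃` worst (`τ₃ ≤ τ₁, τ₂`), the good case `m₃ ≤ m₁₂`, and two disjoint families
`𝓡₁, 𝓡₂` of vertex sets avoiding `a₁, a₂, a₃` (bystander events `O₁ = {a₁↔o} ∪ {C(o) ∈ 𝓡₁}`,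
`O₂ = {a₂↔o} ∪ {C(o) ∈ 𝓡₂}`, `O₁₂ = {a₁↔o} ∪ {a₂↔o} ∪ {C(o) ∈ 𝓡₁} ∪ {C(o) ∈ 𝓡₂}`):
`0 ≤ [μ(N₁₂ ∩ O₁₂ ∩ {a₁↔b,a₂↔b}) − μ(N₁₂ ∩ O₁₂ ∩ {a₃↔b})] + [μ(N₁ ∩ O₁ ∩ {a₁↔b}) − μ(N₁ ∩ O₁ ∩ {a₂↔b,a₃↔b})]
 + [μ(N₂ ∩ O₂ ∩ {a₂↔b}) − μ(N₂ ∩ O₂ ∩ {a₁↔b,a₃↔b})]`.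
KN's proof (p. 9) with the nine BHK applications replaced by sandwich inequalities
(`sandwich_setSource_pos/neg`). [cite: KozmaNitzan2024, Theorem 2 (§3.2, pp. 8–9) and Lemma 2 (p. 6)] -/
theorem bystanderThm2_core (w : Sym2 (Fin n) → unitInterval) (o b a₁ a₂ a₃ : Fin n)
    (𝓡₁ 𝓡₂ : Set (Set (Fin n)))
    (hR₁ : ∀ W ∈ 𝓡₁, a₁ ∉ W ∧ a₂ ∉ W ∧ a₃ ∉ W) (hR₂ : ∀ W ∈ 𝓡₂, a₁ ∉ W ∧ a₂ ∉ W ∧ a₃ ∉ W)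
    (hR : Disjoint 𝓡₁ 𝓡₂)
    (hτ31 : (prodBernoulli w).real (openConn a₃ b) ≤ (prodBernoulli w).real (openConn a₁ b))
    (hτ32 : (prodBernoulli w).real (openConn a₃ b) ≤ (prodBernoulli w).real (openConn a₂ b))
    (hgood : (prodBernoulli w).real (openConn b a₃ ∩ (openConn b a₁)ᶜ ∩ (openConn b a₂)ᶜ) ≤
      (prodBernoulli w).real (openConn b a₁ ∩ openConn b a₂ ∩ (openConn b a₃)ᶜ)) :
    0 ≤ ((prodBernoulli w).real ((openConn a₁ a₃)ᶜ ∩ (openConn a₂ a₃)ᶜ ∩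
            ((openConn a₁ o ∪ openConn a₂ o ∪
                ({ω | openCluster ω o ∈ 𝓡₁} ∪ {ω | openCluster ω o ∈ 𝓡₂})) ∩
              (openConn a₁ b ∩ openConn a₂ b))) -
          (prodBernoulli w).real ((openConn a₁ a₃)ᶜ ∩ (openConn a₂ a₃)ᶜ ∩
            ((openConn a₁ o ∪ openConn a₂ o ∪
                ({ω | openCluster ω o ∈ 𝓡₁} ∪ {ω | openCluster ω o ∈ 𝓡₂})) ∩ openConn a₃ b))) +
        ((prodBernoulli w).real ((openConn a₁ a₂)ᶜ ∩ (openConn a₁ a₃)ᶜ ∩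
            ((openConn a₁ o ∪ {ω | openCluster ω o ∈ 𝓡₁}) ∩ openConn a₁ b)) -
          (prodBernoulli w).real ((openConn a₁ a₂)ᶜ ∩ (openConn a₁ a₃)ᶜ ∩
            ((openConn a₁ o ∪ {ω | openCluster ω o ∈ 𝓡₁}) ∩ (openConn a₂ b ∩ openConn a₃ b)))) +
        ((prodBernoulli w).real ((openConn a₂ a₁)ᶜ ∩ (openConn a₂ a₃)ᶜ ∩
            ((openConn a₂ o ∪ {ω | openCluster ω o ∈ 𝓡₂}) ∩ openConn a₂ b)) -
          (prodBernoulli w).real ((openConn a₂ a₁)ᶜ ∩ (openConn a₂ a₃)ᶜ ∩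
            ((openConn a₂ o ∪ {ω | openCluster ω o ∈ 𝓡₂}) ∩ (openConn a₁ b ∩ openConn a₃ b)))) := by
  set μ := prodBernoulli w with hμ
  set D₁ : Set (BondConfig (Fin n)) := {ω | openCluster ω o ∈ 𝓡₁} with hD₁
  set D₂ : Set (BondConfig (Fin n)) := {ω | openCluster ω o ∈ 𝓡₂} with hD₂
  set O₁₂ : Set (BondConfig (Fin n)) := openConn a₁ o ∪ openConn a₂ o ∪ (D₁ ∪ D₂) with hO₁₂
  set O₁ : Set (BondConfig (Fin n)) := openConn a₁ o ∪ D₁ with hO₁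
  set O₂ : Set (BondConfig (Fin n)) := openConn a₂ o ∪ D₂ with hO₂
  set N₁₂ : Set (BondConfig (Fin n)) := (openConn a₁ a₃)ᶜ ∩ (openConn a₂ a₃)ᶜ with hN₁₂
  set N₁ : Set (BondConfig (Fin n)) := (openConn a₁ a₂)ᶜ ∩ (openConn a₁ a₃)ᶜ with hN₁
  set N₂ : Set (BondConfig (Fin n)) := (openConn a₂ a₁)ᶜ ∩ (openConn a₂ a₃)ᶜ with hN₂
  have hms : ∀ s : Set (BondConfig (Fin n)), MeasurableSet s := fun _ => MeasurableSet.of_discrete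
  -- membership in the pocket events
  have memR₁ : ∀ ω : BondConfig (Fin n), ω ∈ D₁ → ¬ (openGraph ω).Reachable o a₁ ∧
      ¬ (openGraph ω).Reachable o a₂ ∧ ¬ (openGraph ω).Reachable o a₃ := by
    intro ω hω
    obtain ⟨h1, h2, h3⟩ := hR₁ _ hω
    exact ⟨fun h => h1 h, fun h => h2 h, fun h => h3 h⟩
  have memR₂ : ∀ ω : BondConfig (Fin n), ω ∈ D₂ → ¬ (openGraph ω).Reachable o a₁ ∧
      ¬ (openGraph ω).Reachable o a₂ ∧ ¬ (openGraph ω).Reachable o a₃ := by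
    intro ω hω
    obtain ⟨h1, h2, h3⟩ := hR₂ _ hω
    exact ⟨fun h => h1 h, fun h => h2 h, fun h => h3 h⟩
  /- the six sandwich descriptions of the bystander events -/
  have q12pos : ∀ ω ∈ {ω : BondConfig (Fin n) | ∀ s ∈ ({a₁, a₂} : Finset (Fin n)),
      ∀ t ∈ ({a₃} : Set (Fin n)), ¬ (openGraph ω).Reachable s t},
      ω ∈ O₁₂ ↔ ((∃ s ∈ ({a₁, a₂} : Finset (Fin n)), (openGraph ω).Reachable s o) ∨
        ((∀ t ∈ ({a₃} : Set (Fin n)), ¬ (openGraph ω).Reachable o t) ∧ openCluster ω o ∈ 𝓡₁ ∪ 𝓡₂)) := by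
    intro ω _
    simp only [hO₁₂, Set.mem_union, Finset.mem_insert, Finset.mem_singleton, exists_eq_or_imp,
      exists_eq_left, Set.mem_singleton_iff, forall_eq]
    constructor
    · rintro ((h1 | h2) | (hd | hd))
      · exact Or.inl (Or.inl h1)
      · exact Or.inl (Or.inr h2)
      · exact Or.inr ⟨(memR₁ ω hd).2.2, Or.inl hd⟩
      · exact Or.inr ⟨(memR₂ ω hd).2.2, Or.inr hd⟩
    · rintro ((h1 | h2) | ⟨-, (hd | hd)⟩)
      · exact Or.inl (Or.inl h1)
      · exact Or.inl (Or.inr h2)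
      · exact Or.inr (Or.inl hd)
      · exact Or.inr (Or.inr hd)
  have q12neg : ∀ ω ∈ {ω : BondConfig (Fin n) | ∀ s ∈ ({a₃} : Finset (Fin n)),
      ∀ t ∈ ({a₁, a₂} : Set (Fin n)), ¬ (openGraph ω).Reachable s t},
      ω ∈ O₁₂ ↔ ((¬ ∃ s ∈ ({a₃} : Finset (Fin n)), (openGraph ω).Reachable s o) ∧
        ((∃ t ∈ ({a₁, a₂} : Set (Fin n)), (openGraph ω).Reachable o t) ∨ openCluster ω o ∈ 𝓡₁ ∪ 𝓡₂)) := by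
    intro ω hω
    simp only [Set.mem_setOf_eq, Finset.mem_singleton, forall_eq, Set.mem_insert_iff,
      Set.mem_singleton_iff, forall_eq_or_imp] at hω
    simp only [hO₁₂, Set.mem_union, Finset.mem_singleton, exists_eq_left, Set.mem_insert_iff,
      Set.mem_singleton_iff, exists_eq_or_imp, exists_eq_left]
    constructor
    · rintro ((h1 | h2) | (hd | hd))
      · exact ⟨fun h => hω.1 (h.trans (SimpleGraph.Reachable.symm h1)), Or.inl (Or.inl h1.symm)⟩
      · exact ⟨fun h => hω.2 (h.trans (SimpleGraph.Reachable.symm h2)), Or.inl (Or.inr h2.symm)⟩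
      · exact ⟨fun h => (memR₁ ω hd).2.2 h.symm, Or.inr (Or.inl hd)⟩
      · exact ⟨fun h => (memR₂ ω hd).2.2 h.symm, Or.inr (Or.inr hd)⟩
    · rintro ⟨-, (h1 | h2) | (hd | hd)⟩
      · exact Or.inl (Or.inl h1.symm)
      · exact Or.inl (Or.inr h2.symm)
      · exact Or.inr (Or.inl hd)
      · exact Or.inr (Or.inr hd)
  have q1pos : ∀ ω ∈ {ω : BondConfig (Fin n) | ∀ s ∈ ({a₁} : Finset (Fin n)),
      ∀ t ∈ ({a₂, a₃} : Set (Fin n)), ¬ (openGraph ω).Reachable s t},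
      ω ∈ O₁ ↔ ((∃ s ∈ ({a₁} : Finset (Fin n)), (openGraph ω).Reachable s o) ∨
        ((∀ t ∈ ({a₂, a₃} : Set (Fin n)), ¬ (openGraph ω).Reachable o t) ∧ openCluster ω o ∈ 𝓡₁)) := by
    intro ω _
    simp only [hO₁, Set.mem_union, Finset.mem_singleton, exists_eq_left, Set.mem_insert_iff,
      Set.mem_singleton_iff, forall_eq_or_imp, forall_eq]
    constructor
    · rintro (h1 | hd)
      · exact Or.inl h1
      · exact Or.inr ⟨⟨(memR₁ ω hd).2.1, (memR₁ ω hd).2.2⟩, hd⟩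
    · rintro (h1 | ⟨-, hd⟩)
      · exact Or.inl h1
      · exact Or.inr hd
  have q1neg : ∀ ω ∈ {ω : BondConfig (Fin n) | ∀ s ∈ ({a₂, a₃} : Finset (Fin n)),
      ∀ t ∈ ({a₁} : Set (Fin n)), ¬ (openGraph ω).Reachable s t},
      ω ∈ O₁ ↔ ((¬ ∃ s ∈ ({a₂, a₃} : Finset (Fin n)), (openGraph ω).Reachable s o) ∧
        ((∃ t ∈ ({a₁} : Set (Fin n)), (openGraph ω).Reachable o t) ∨ openCluster ω o ∈ 𝓡₁)) := by
    intro ω hω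
    simp only [Set.mem_setOf_eq, Finset.mem_insert, Finset.mem_singleton, forall_eq_or_imp, forall_eq,
      Set.mem_singleton_iff] at hω
    simp only [hO₁, Set.mem_union, Finset.mem_insert, Finset.mem_singleton, exists_eq_or_imp,
      exists_eq_left, Set.mem_singleton_iff, not_or]
    constructor
    · rintro (h1 | hd)
      · exact ⟨⟨fun h => hω.1 (h.trans (SimpleGraph.Reachable.symm h1)),
          fun h => hω.2 (h.trans (SimpleGraph.Reachable.symm h1))⟩, Or.inl h1.symm⟩
      · exact ⟨⟨fun h => (memR₁ ω hd).2.1 h.symm, fun h => (memR₁ ω hd).2.2 h.symm⟩, Or.inr hd⟩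
    · rintro ⟨-, h1 | hd⟩
      · exact Or.inl h1.symm
      · exact Or.inr hd
  have q2pos : ∀ ω ∈ {ω : BondConfig (Fin n) | ∀ s ∈ ({a₂} : Finset (Fin n)),
      ∀ t ∈ ({a₁, a₃} : Set (Fin n)), ¬ (openGraph ω).Reachable s t},
      ω ∈ O₂ ↔ ((∃ s ∈ ({a₂} : Finset (Fin n)), (openGraph ω).Reachable s o) ∨
        ((∀ t ∈ ({a₁, a₃} : Set (Fin n)), ¬ (openGraph ω).Reachable o t) ∧ openCluster ω o ∈ 𝓡₂)) := by
    intro ω _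
    simp only [hO₂, Set.mem_union, Finset.mem_singleton, exists_eq_left, Set.mem_insert_iff,
      Set.mem_singleton_iff, forall_eq_or_imp, forall_eq]
    constructor
    · rintro (h1 | hd)
      · exact Or.inl h1
      · exact Or.inr ⟨⟨(memR₂ ω hd).1, (memR₂ ω hd).2.2⟩, hd⟩
    · rintro (h1 | ⟨-, hd⟩)
      · exact Or.inl h1
      · exact Or.inr hd
  have q2neg : ∀ ω ∈ {ω : BondConfig (Fin n) | ∀ s ∈ ({a₁, a₃} : Finset (Fin n)),
      ∀ t ∈ ({a₂} : Set (Fin n)), ¬ (openGraph ω).Reachable s t},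
      ω ∈ O₂ ↔ ((¬ ∃ s ∈ ({a₁, a₃} : Finset (Fin n)), (openGraph ω).Reachable s o) ∧
        ((∃ t ∈ ({a₂} : Set (Fin n)), (openGraph ω).Reachable o t) ∨ openCluster ω o ∈ 𝓡₂)) := by
    intro ω hω
    simp only [Set.mem_setOf_eq, Finset.mem_insert, Finset.mem_singleton, forall_eq_or_imp, forall_eq,
      Set.mem_singleton_iff] at hω
    simp only [hO₂, Set.mem_union, Finset.mem_insert, Finset.mem_singleton, exists_eq_or_imp,
      exists_eq_left, Set.mem_singleton_iff, not_or]
    constructor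
    · rintro (h1 | hd)
      · exact ⟨⟨fun h => hω.1 (h.trans (SimpleGraph.Reachable.symm h1)),
          fun h => hω.2 (h.trans (SimpleGraph.Reachable.symm h1))⟩, Or.inl h1.symm⟩
      · exact ⟨⟨fun h => (memR₂ ω hd).1 h.symm, fun h => (memR₂ ω hd).2.2 h.symm⟩, Or.inr hd⟩
    · rintro ⟨-, h1 | hd⟩
      · exact Or.inl h1.symm
      · exact Or.inr hd
  /- the nine sandwich inequalities -/
  -- (1): one-cluster, `S = {a₁,a₂}`, `T = {a₃}`, `E = {a₁↔b} ∩ {a₂↔b}`, `Q = O₁₂`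
  have i1 := sandwich_setSource_pos w {a₁, a₂} o ({a₃} : Set (Fin n)) _
    (knThm2_monotone_allReach {a₁, a₂} b) _ O₁₂ (knThm2_allReach_apply {a₁, a₂} b) (𝓡₁ ∪ 𝓡₂) q12pos
  rw [knThm2_sep_pair_set, v1362_biInter_pair] at i1
  -- (1'): one-cluster, `S = {a₁,a₂}`, `T = {a₃}`, `E = {a₁↔a₂}`, `Q = O₁₂` (Lemma 2, step (ii))
  have i1' := sandwich_setSource_pos w {a₁, a₂} o ({a₃} : Set (Fin n)) _
    (knThm2_monotone_allReach {a₁, a₂} a₂) _ O₁₂ (knThm2_allReach_apply {a₁, a₂} a₂) (𝓡₁ ∪ 𝓡₂) q12pos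
  rw [knThm2_sep_pair_set, v1362_biInter_pair_self] at i1'
  -- (2): two-cluster, `S = {a₃}`, `T = {a₁,a₂}`, `E = {a₃↔b}`, `Q' = O₁₂`
  have i2 := sandwich_setSource_neg w {a₃} o ({a₁, a₂} : Set (Fin n)) _
    (knThm2_monotone_allReach {a₃} b) _ O₁₂ (knThm2_allReach_apply {a₃} b) (𝓡₁ ∪ 𝓡₂) q12neg
  rw [knThm2_sep_single_set, v1362_biInter_single, knThm2_openConn_comm a₃ a₁,
    knThm2_openConn_comm a₃ a₂] at i2
  -- (3): one-cluster, `S = {a₁}`, `T = {a₂,a₃}`, `E = {a₁↔b}`, `Q = O₁`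
  have i3 := sandwich_setSource_pos w {a₁} o ({a₂, a₃} : Set (Fin n)) _
    (knThm2_monotone_allReach {a₁} b) _ O₁ (knThm2_allReach_apply {a₁} b) 𝓡₁ q1pos
  rw [knThm2_sep_single_set, v1362_biInter_single] at i3
  -- (4): two-cluster, `S = {a₂,a₃}`, `T = {a₁}`, `E = {a₂↔b} ∩ {a₃↔b}`, `Q' = O₁`
  have i4 := sandwich_setSource_neg w {a₂, a₃} o ({a₁} : Set (Fin n)) _
    (knThm2_monotone_allReach {a₂, a₃} b) _ O₁ (knThm2_allReach_apply {a₂, a₃} b) 𝓡₁ q1neg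
  rw [knThm2_sep_pair_set, v1362_biInter_pair, knThm2_openConn_comm a₂ a₁,
    knThm2_openConn_comm a₃ a₁] at i4
  -- (4'): two-cluster, `S = {a₂,a₃}`, `T = {a₁}`, `E = {a₂↔a₃}`, `Q' = O₁` (Lemma 2, step (i), k = 1)
  have i4' := sandwich_setSource_neg w {a₂, a₃} o ({a₁} : Set (Fin n)) _
    (knThm2_monotone_allReach {a₂, a₃} a₃) _ O₁ (knThm2_allReach_apply {a₂, a₃} a₃) 𝓡₁ q1neg
  rw [knThm2_sep_pair_set, v1362_biInter_pair_self, knThm2_openConn_comm a₂ a₁,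
    knThm2_openConn_comm a₃ a₁] at i4'
  -- (5): one-cluster, `S = {a₂}`, `T = {a₁,a₃}`, `E = {a₂↔b}`, `Q = O₂`
  have i5 := sandwich_setSource_pos w {a₂} o ({a₁, a₃} : Set (Fin n)) _
    (knThm2_monotone_allReach {a₂} b) _ O₂ (knThm2_allReach_apply {a₂} b) 𝓡₂ q2pos
  rw [knThm2_sep_single_set, v1362_biInter_single] at i5
  -- (6): two-cluster, `S = {a₁,a₃}`, `T = {a₂}`, `E = {a₁↔b} ∩ {a₃↔b}`, `Q' = O₂`
  have i6 := sandwich_setSource_neg w {a₁, a₃} o ({a₂} : Set (Fin n)) _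
    (knThm2_monotone_allReach {a₁, a₃} b) _ O₂ (knThm2_allReach_apply {a₁, a₃} b) 𝓡₂ q2neg
  rw [knThm2_sep_pair_set, v1362_biInter_pair, knThm2_openConn_comm a₁ a₂,
    knThm2_openConn_comm a₃ a₂] at i6
  -- (6'): two-cluster, `S = {a₁,a₃}`, `T = {a₂}`, `E = {a₁↔a₃}`, `Q' = O₂` (Lemma 2, step (i), k = 2)
  have i6' := sandwich_setSource_neg w {a₁, a₃} o ({a₂} : Set (Fin n)) _
    (knThm2_monotone_allReach {a₁, a₃} a₃) _ O₂ (knThm2_allReach_apply {a₁, a₃} a₃) 𝓡₂ q2neg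
  rw [knThm2_sep_pair_set, v1362_biInter_pair_self, knThm2_openConn_comm a₁ a₂,
    knThm2_openConn_comm a₃ a₂] at i6'
  /- Lemma 2 for the bystander events: `A₁ P₁₂ P₂ + A₂ P₁₂ P₁ ≤ A₁₂ P₁ P₂` -/
  set M : Set (BondConfig (Fin n)) := (openConn a₁ a₂)ᶜ ∩ (openConn a₁ a₃)ᶜ ∩ (openConn a₂ a₃)ᶜ
    with hM
  have eM1 : N₁ ∩ (openConn a₂ a₃)ᶜ = M := rfl
  have eM2 : N₂ ∩ (openConn a₁ a₃)ᶜ = M := by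
    ext ω
    simp only [hN₂, hM, Set.mem_inter_iff, Set.mem_compl_iff, knThm2_mem_openConn]
    rw [SimpleGraph.reachable_comm (u := a₂) (v := a₁)]
    tauto
  have eM12 : N₁₂ ∩ (openConn a₁ a₂)ᶜ = M := by
    ext ω
    simp only [hN₁₂, hM, Set.mem_inter_iff, Set.mem_compl_iff]
    tauto
  have eM3 : N₁ ∩ N₂ = M := by
    ext ω
    simp only [hN₁, hN₂, hM, Set.mem_inter_iff, Set.mem_compl_iff, knThm2_mem_openConn]
    rw [SimpleGraph.reachable_comm (u := a₂) (v := a₁)]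
    tauto
  -- step (i), k = 1: `A₁ μ(M) ≤ μ(M ∩ O₁) P₁`
  have jA1 : μ.real (N₁ ∩ O₁) * μ.real M ≤ μ.real (M ∩ O₁) * μ.real N₁ := by
    have hq : μ.real (N₁ ∩ openConn a₂ a₃) + μ.real (N₁ ∩ (openConn a₂ a₃)ᶜ) = μ.real N₁ :=
      measureReal_inter_add_sdiff (hms _)
    have hx : μ.real (N₁ ∩ (openConn a₂ a₃ ∩ O₁)) + μ.real (N₁ ∩ ((openConn a₂ a₃)ᶜ ∩ O₁)) =
        μ.real (N₁ ∩ O₁) := by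
      have := measureReal_inter_add_sdiff (μ := μ) (s := N₁ ∩ O₁) (hms (openConn a₂ a₃))
      rw [show N₁ ∩ O₁ ∩ openConn a₂ a₃ = N₁ ∩ (openConn a₂ a₃ ∩ O₁) by
          rw [Set.inter_assoc, Set.inter_comm O₁],
        show (N₁ ∩ O₁) \ openConn a₂ a₃ = N₁ ∩ ((openConn a₂ a₃)ᶜ ∩ O₁) by
          rw [Set.sdiff_eq, Set.inter_assoc, Set.inter_comm O₁]] at this
      exact this
    have key : μ.real N₁ * μ.real (N₁ ∩ (openConn a₂ a₃ ∩ O₁)) ≤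
        μ.real (N₁ ∩ O₁) * μ.real (N₁ ∩ openConn a₂ a₃) := by linarith [i4']
    have := knLemma2_arith_twoCluster hq hx key
    rw [eM1] at this
    rwa [show N₁ ∩ ((openConn a₂ a₃)ᶜ ∩ O₁) = M ∩ O₁ by rw [← Set.inter_assoc, eM1]] at this
  -- step (i), k = 2: `A₂ μ(M) ≤ μ(M ∩ O₂) P₂`
  have jA2 : μ.real (N₂ ∩ O₂) * μ.real M ≤ μ.real (M ∩ O₂) * μ.real N₂ := by
    have hq : μ.real (N₂ ∩ openConn a₁ a₃) + μ.real (N₂ ∩ (openConn a₁ a₃)ᶜ) = μ.real N₂ :=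
      measureReal_inter_add_sdiff (hms _)
    have hx : μ.real (N₂ ∩ (openConn a₁ a₃ ∩ O₂)) + μ.real (N₂ ∩ ((openConn a₁ a₃)ᶜ ∩ O₂)) =
        μ.real (N₂ ∩ O₂) := by
      have := measureReal_inter_add_sdiff (μ := μ) (s := N₂ ∩ O₂) (hms (openConn a₁ a₃))
      rw [show N₂ ∩ O₂ ∩ openConn a₁ a₃ = N₂ ∩ (openConn a₁ a₃ ∩ O₂) by
          rw [Set.inter_assoc, Set.inter_comm O₂],
        show (N₂ ∩ O₂) \ openConn a₁ a₃ = N₂ ∩ ((openConn a₁ a₃)ᶜ ∩ O₂) by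
          rw [Set.sdiff_eq, Set.inter_assoc, Set.inter_comm O₂]] at this
      exact this
    have key : μ.real N₂ * μ.real (N₂ ∩ (openConn a₁ a₃ ∩ O₂)) ≤
        μ.real (N₂ ∩ O₂) * μ.real (N₂ ∩ openConn a₁ a₃) := by linarith [i6']
    have := knLemma2_arith_twoCluster hq hx key
    rw [eM2] at this
    rwa [show N₂ ∩ ((openConn a₁ a₃)ᶜ ∩ O₂) = M ∩ O₂ by rw [← Set.inter_assoc, eM2]] at this
  -- step (ii): `μ(M ∩ O₁₂) P₁₂ ≤ A₁₂ μ(M)`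
  have jC : μ.real (M ∩ O₁₂) * μ.real N₁₂ ≤ μ.real (N₁₂ ∩ O₁₂) * μ.real M := by
    have hq : μ.real (N₁₂ ∩ openConn a₁ a₂) + μ.real (N₁₂ ∩ (openConn a₁ a₂)ᶜ) = μ.real N₁₂ :=
      measureReal_inter_add_sdiff (hms _)
    have hx : μ.real (N₁₂ ∩ (openConn a₁ a₂ ∩ O₁₂)) + μ.real (N₁₂ ∩ ((openConn a₁ a₂)ᶜ ∩ O₁₂)) =
        μ.real (N₁₂ ∩ O₁₂) := by
      have := measureReal_inter_add_sdiff (μ := μ) (s := N₁₂ ∩ O₁₂) (hms (openConn a₁ a₂))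
      rw [show N₁₂ ∩ O₁₂ ∩ openConn a₁ a₂ = N₁₂ ∩ (openConn a₁ a₂ ∩ O₁₂) by
          rw [Set.inter_assoc, Set.inter_comm O₁₂],
        show (N₁₂ ∩ O₁₂) \ openConn a₁ a₂ = N₁₂ ∩ ((openConn a₁ a₂)ᶜ ∩ O₁₂) by
          rw [Set.sdiff_eq, Set.inter_assoc, Set.inter_comm O₁₂]] at this
      exact this
    have key : μ.real (N₁₂ ∩ O₁₂) * μ.real (N₁₂ ∩ openConn a₁ a₂) ≤
        μ.real N₁₂ * μ.real (N₁₂ ∩ (openConn a₁ a₂ ∩ O₁₂)) := by linarith [i1']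
    have := knLemma2_arith_oneCluster hq hx key
    rw [eM12] at this
    rwa [show N₁₂ ∩ ((openConn a₁ a₂)ᶜ ∩ O₁₂) = M ∩ O₁₂ by rw [← Set.inter_assoc, eM12]] at this
  -- disjointness of `O₁`, `O₂` on `M`, and `O₁ ∪ O₂ = O₁₂`
  have hy : μ.real (M ∩ O₁) + μ.real (M ∩ O₂) = μ.real (M ∩ O₁₂) := by
    have hU : M ∩ O₁₂ = M ∩ O₁ ∪ M ∩ O₂ := by
      rw [← Set.inter_union_distrib_left]
      congr 1
      simp only [hO₁₂, hO₁, hO₂]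
      ext ω; simp only [Set.mem_union]; tauto
    rw [hU]
    refine (measureReal_union (Set.disjoint_left.2 fun ω hω₁ hω₂ => ?_) (hms _)).symm
    obtain ⟨hωM, h1 | hd1⟩ := hω₁
    · rcases hω₂.2 with h2 | hd2
      · exact hωM.1.1 ((show (openGraph ω).Reachable a₁ o from h1).trans
          (show (openGraph ω).Reachable a₂ o from h2).symm)
      · exact (memR₂ ω hd2).1 (show (openGraph ω).Reachable a₁ o from h1).symm
    · rcases hω₂.2 with h2 | hd2
      · exact (memR₁ ω hd1).2.1 (show (openGraph ω).Reachable a₂ o from h2).symm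
      · exact Set.disjoint_left.1 hR hd1 hd2
  -- Harris: `N₁`, `N₂` are decreasing, `N₁ ∩ N₂ = M`
  have hHM := prodBernoulli_harris_lower w
    (((isUpperSet_openConn a₁ a₂).compl).inter (isUpperSet_openConn a₁ a₃).compl)
    (((isUpperSet_openConn a₂ a₁).compl).inter (isUpperSet_openConn a₂ a₃).compl) (hms _) (hms _)
  rw [eM3] at hHM
  have hL := knLemma2_arith measureReal_nonneg measureReal_nonneg measureReal_nonneg measureReal_nonneg
    measureReal_nonneg measureReal_nonneg (measureReal_mono Set.inter_subset_left)
    (measureReal_mono Set.inter_subset_left) jA1 jA2 jC hy hHM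
  /- the six bounds in the shape of `knThm2_arith` -/
  have h1 : μ.real (N₁₂ ∩ O₁₂) * μ.real (N₁₂ ∩ (openConn a₁ b ∩ openConn a₂ b)) ≤
      μ.real N₁₂ * μ.real (N₁₂ ∩ (O₁₂ ∩ (openConn a₁ b ∩ openConn a₂ b))) := by
    rw [Set.inter_comm O₁₂]; linarith [i1]
  have h2 : μ.real N₁₂ * μ.real (N₁₂ ∩ (O₁₂ ∩ openConn a₃ b)) ≤
      μ.real (N₁₂ ∩ O₁₂) * μ.real (N₁₂ ∩ openConn a₃ b) := by
    rw [Set.inter_comm O₁₂]; linarith [i2]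
  have h3 : μ.real (N₁ ∩ O₁) * μ.real (N₁ ∩ openConn a₁ b) ≤
      μ.real N₁ * μ.real (N₁ ∩ (O₁ ∩ openConn a₁ b)) := by
    rw [Set.inter_comm O₁]; linarith [i3]
  have h4 : μ.real N₁ * μ.real (N₁ ∩ (O₁ ∩ (openConn a₂ b ∩ openConn a₃ b))) ≤
      μ.real (N₁ ∩ O₁) * μ.real (N₁ ∩ (openConn a₂ b ∩ openConn a₃ b)) := by
    rw [Set.inter_comm O₁]; linarith [i4]
  have h5 : μ.real (N₂ ∩ O₂) * μ.real (N₂ ∩ openConn a₂ b) ≤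
      μ.real N₂ * μ.real (N₂ ∩ (O₂ ∩ openConn a₂ b)) := by
    rw [Set.inter_comm O₂]; linarith [i5]
  have h6 : μ.real N₂ * μ.real (N₂ ∩ (O₂ ∩ (openConn a₁ b ∩ openConn a₃ b))) ≤
      μ.real (N₂ ∩ O₂) * μ.real (N₂ ∩ (openConn a₁ b ∩ openConn a₃ b)) := by
    rw [Set.inter_comm O₂]; linarith [i6]
  /- KN's arithmetic -/
  have hH2 := knThm2_harris w a₁ a₂ a₃
  have hH1 := knThm2_harris w a₂ a₁ a₃
  rw [Set.inter_comm (openConn a₂ a₃)ᶜ (openConn a₁ a₃)ᶜ] at hH1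
  have hτ1 := knThm2_tau_sub w b a₁ a₂ a₃
  have hτ2 := knThm2_tau_sub w b a₂ a₁ a₃
  rw [Set.inter_comm (openConn a₂ a₃)ᶜ (openConn a₁ a₃)ᶜ,
    Set.inter_comm (openConn a₂ b) (openConn a₁ b)] at hτ2
  rw [knThm2_m3, knThm2_m12] at hgood
  exact knThm2_arith measureReal_nonneg measureReal_nonneg measureReal_nonneg
    (measureReal_mono Set.inter_subset_left) (measureReal_mono Set.inter_subset_left)
    (measureReal_mono Set.inter_subset_left) measureReal_nonneg measureReal_nonneg
    measureReal_nonneg measureReal_nonneg measureReal_nonneg measureReal_nonneg measureReal_nonneg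
    (measureReal_mono Set.inter_subset_left) h1 h2 h3 h4 h5 h6 hL hgood (by linarith)
    (by linarith) hH1 hH2

end

/-! ### Registered stub form -/

/-- **Registered stub `stub_bystanderThm2Core_v1362`** (= `bystanderThm2_core`): Kozma–Nitzan's
Theorem 2, core inequality `0 ≤ I* + II* + III*`, for a virtual observer (bystander events built from two
disjoint dead-pocket families) — the engine of GOOD for three relays in the good case with the
dead-pocket penalty (TTRL variant V1362 of `stub_goodStep`).
[cite: KozmaNitzan2024, Theorem 2 (§3.2, pp. 8–9)] -/
theorem stub_bystanderThm2Core_v1362 : ∀ (n : ℕ) (w : Sym2 (Fin n) → unitInterval) (o b a₁ a₂ a₃ : Fin n) (𝓡₁ 𝓡₂ : Set (Set (Fin n))), (∀ W ∈ 𝓡₁, a₁ ∉ W ∧ a₂ ∉ W ∧ a₃ ∉ W) → (∀ W ∈ 𝓡₂, a₁ ∉ W ∧ a₂ ∉ W ∧ a₃ ∉ W) → Disjoint 𝓡₁ 𝓡₂ → (Literature.Probability.LatticeModels.prodBernoulli w).real (Literature.Probability.Percolation.openConn a₃ b) ≤ (Literature.Probability.LatticeModels.prodBernoulli w).real (Literature.Probability.Percolation.openConn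 a₁ b) → (Literature.Probability.LatticeModels.prodBernoulli w).real (Literature.Probability.Percolation.openConn a₃ b) ≤ (Literature.Probability.LatticeModels.prodBernoulli w).real (Literature.Probability.Percolation.openConn a₂ b) → (Literature.Probability.LatticeModels.prodBernoulli w).real (Literature.Probability.Percolation.openConn b a₃ ∩ (Literature.Probability.Percolation.openConn b a₁)ᶜ ∩ (Literature.Probability.Percolation.openConn b a₂)ᶜ) ≤ (Literature.Probability.LatticeModels.prodBernoulli w).real (Literature.Probability.Percolation.openConn b a₁ ∩ Literature.Probability.Percolation.openConn b a₂ ∩ (Literature.Probability.Percolation.openConn b a₃)ᶜ) → 0 ≤ ((Literature.Probability.LatticeModels.prodBernoulli w).real ((Literature.Probability.Percolation.openConn a₁ a₃)ᶜ ∩ (Literature.Probability.Percolation.openConn a₂ a₃)ᶜ ∩ ((Literature.Probability.Percolation.openConn a₁ o ∪ Literature.Probability.Percolation.openConn a₂ o ∪ ({ω : Set (Sym2 (Fin n)) | Literature.Probability.Percolation.openCluster ω o ∈ 𝓡₁} ∪ {ω : Set (Sym2 (Fin n)) | Literature.Probability.Percolation.openCluster ω o ∈ 𝓡₂})) ∩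 (Literature.Probability.Percolation.openConn a₁ b ∩ Literature.Probability.Percolation.openConn a₂ b))) - (Literature.Probability.LatticeModels.prodBernoulli w).real ((Literature.Probability.Percolation.openConn a₁ a₃)ᶜ ∩ (Literature.Probability.Percolation.openConn a₂ a₃)ᶜ ∩ ((Literature.Probability.Percolation.openConn a₁ o ∪ Literature.Probability.Percolation.openConn a₂ o ∪ ({ω : Set (Sym2 (Fin n)) | Literature.Probability.Percolation.openCluster ω o ∈ 𝓡₁} ∪ {ω : Set (Sym2 (Fin n)) | Literature.Probability.Percolation.openCluster ω o ∈ 𝓡₂})) ∩ Literature.Probability.Percolation.openConn a₃ b))) + ((Literature.Probability.LatticeModels.prodBernoulli w).real ((Literature.Probability.Percolation.openConn a₁ a₂)ᶜ ∩ (Literature.Probability.Percolation.openConn a₁ a₃)ᶜ ∩ ((Literature.Probability.Percolation.openConn a₁ o ∪ {ω : Set (Sym2 (Fin n)) | Literature.Probability.Percolation.openCluster ω o ∈ 𝓡₁}) ∩ Literature.Probability.Percolation.openConn a₁ b)) - (Literature.Probability.LatticeModels.prodBernoulli w).real ((Literature.Probability.Percolation.openConn a₁ a₂)ᶜ ∩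 (Literature.Probability.Percolation.openConn a₁ a₃)ᶜ ∩ ((Literature.Probability.Percolation.openConn a₁ o ∪ {ω : Set (Sym2 (Fin n)) | Literature.Probability.Percolation.openCluster ω o ∈ 𝓡₁}) ∩ (Literature.Probability.Percolation.openConn a₂ b ∩ Literature.Probability.Percolation.openConn a₃ b)))) + ((Literature.Probability.LatticeModels.prodBernoulli w).real ((Literature.Probability.Percolation.openConn a₂ a₁)ᶜ ∩ (Literature.Probability.Percolation.openConn a₂ a₃)ᶜ ∩ ((Literature.Probability.Percolation.openConn a₂ o ∪ {ω : Set (Sym2 (Fin n)) | Literature.Probability.Percolation.openCluster ω o ∈ 𝓡₂}) ∩ Literature.Probability.Percolation.openConn a₂ b)) - (Literature.Probability.LatticeModels.prodBernoulli w).real ((Literature.Probability.Percolation.openConn a₂ a₁)ᶜ ∩ (Literature.Probability.Percolation.openConn a₂ a₃)ᶜ ∩ ((Literature.Probability.Percolation.openConn a₂ o ∪ {ω : Set (Sym2 (Fin n)) | Literature.Probability.Percolation.openCluster ω o ∈ 𝓡₂}) ∩ (Literature.Probability.Percolation.openConn a₁ b ∩ Literature.Probability.Percolation.openConn a₃ b))))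 :=
  fun _ w o b a₁ a₂ a₃ 𝓡₁ 𝓡₂ hR₁ hR₂ hR hτ31 hτ32 hgood =>
    bystanderThm2_core w o b a₁ a₂ a₃ 𝓡₁ 𝓡₂ hR₁ hR₂ hR hτ31 hτ32 hgood

end Summit.CriticalPhenomena.PercolationContinuityZ3.Theorems
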